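import Mathlib
import Literature.AlgebraicGeometry.Resolution.WeightedResolutionDatum
import HarnessLib

/-!
# (H3) of (K-wild-hom), step 2a: the SLOT SPLITTING of a weighted monomial piece — `J_{wₗ}(u) = (uₗ) ⊔ J_{wₗ}(u with uₗ := 0)`

Route `ResolutionOfSingularities/WeightedInvariant`, door crux `HypersurfaceCentreConstruction` (stmt-ResolutionOfSingularities-19897), P3 rung;
ORDER (o50) of res-L1-w43-plan-1, kernel item (H3) (memo `plan/tools/res-type-060/o50/K-WILD-HOM.md` §2/§6), step 2a; res-type-060 (gen 10).
[OURS · L1 W4.3 · helper, counted 0] — over `Literature…WeightedResolutionDatum.weightedMonomialIdeal` only.  AI proof, weaker than expert review.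

* `KWildHom.weightedMonomialIdeal_update_zero_le` — the monomials avoiding the slot `l` form a sub-piece: `J_n(u[l ↦ 0]) ≤ J_n(u)` for every `n`.
* `KWildHom.weightedMonomialIdeal_weight_eq_span_sup` — **`J_{wₗ}(u) = (uₗ) ⊔ J_{wₗ}(u[l ↦ 0])`**: a monomial of weight `≥ wₗ` either contains
  `uₗ` or avoids it.  With step 1 (`…KWildHomSlotNakayama`: per-slot Nakayama extraction) this replaces the slot `uₗ` by a HOMOGENEOUS generator up
  to `J′ = J_{wₗ}(u[l ↦ 0])`; step 2b = the jets lemma `weightedMonomialIdeal_eq_of_forall_sub_mem` (…CentreFiltrationNotDeterminedByCentre).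
-/

set_option linter.dupNamespace false -- mandated namespace of this single-conjunct summit

namespace Summit.ResolutionOfSingularities.ResolutionOfSingularities.Theorems

namespace KWildHom

open Literature.AlgebraicGeometry.Resolution

variable {A : Type*} [CommRing A] {m : ℕ} (u : Fin m → A) (w : Fin m → ℕ) (l : Fin m)

/-- The monomials avoiding the slot `l` form a sub-piece. [folklore] -/
theorem weightedMonomialIdeal_update_zero_le (n : ℕ) :
    weightedMonomialIdeal (Function.update u l 0) w n ≤ weightedMonomialIdeal u w n := by
  classical
  unfold weightedMonomialIdeal
  refine Ideal.span_le.mpr ?_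
  rintro x ⟨α, hα, rfl⟩
  by_cases hl : α l = 0
  · refine Ideal.subset_span ⟨α, hα, ?_⟩
    refine Finset.prod_congr rfl fun i _ => ?_
    by_cases hi : i = l
    · subst hi; rw [hl, pow_zero, pow_zero]
    · rw [Function.update_of_ne hi]
  · have : (∏ i, Function.update u l 0 i ^ α i) = 0 := by
      refine Finset.prod_eq_zero (Finset.mem_univ l) ?_
      rw [Function.update_self, zero_pow hl]
    rw [this]
    exact Ideal.zero_mem _

/-- **SLOT SPLITTING**: `J_{wₗ}(u) = (uₗ) ⊔ J_{wₗ}(u[l ↦ 0])`. [OURS · L1 W4.3] -/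
theorem weightedMonomialIdeal_weight_eq_span_sup :
    weightedMonomialIdeal u w (w l) = Ideal.span {u l} ⊔ weightedMonomialIdeal (Function.update u l 0) w (w l) := by
  classical
  refine le_antisymm ?_ (sup_le ?_ (weightedMonomialIdeal_update_zero_le u w l _))
  · unfold weightedMonomialIdeal
    refine Ideal.span_le.mpr ?_
    rintro x ⟨α, hα, rfl⟩
    by_cases hl : α l = 0
    · refine Ideal.mem_sup_right (Ideal.subset_span ⟨α, hα, ?_⟩)
      refine Finset.prod_congr rfl fun i _ => ?_
      by_cases hi : i = l
      · subst hi; rw [hl, pow_zero, pow_zero]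
      · rw [Function.update_of_ne hi]
    · refine Ideal.mem_sup_left (Ideal.mem_span_singleton'.mpr ?_)
      obtain ⟨k, hk⟩ := Nat.exists_eq_succ_of_ne_zero hl
      refine ⟨u l ^ k * ∏ i ∈ Finset.univ.erase l, u i ^ α i, ?_⟩
      rw [← Finset.mul_prod_erase Finset.univ (fun i => u i ^ α i) (Finset.mem_univ l), hk, pow_succ]
      ring
  · rw [Ideal.span_singleton_le_iff_mem]
    unfold weightedMonomialIdeal
    refine Ideal.subset_span ⟨Pi.single l 1, ?_, ?_⟩
    · rw [Finset.sum_eq_single l (fun i _ hi => by rw [Pi.single_eq_of_ne hi, mul_zero]) (fun h => absurd (Finset.mem_univ _) h),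
        Pi.single_eq_same, mul_one]
    · rw [Finset.prod_eq_single l (fun i _ hi => by rw [Pi.single_eq_of_ne hi, pow_zero]) (fun h => absurd (Finset.mem_univ _) h),
        Pi.single_eq_same, pow_one]

end KWildHom

end Summit.ResolutionOfSingularities.ResolutionOfSingularities.Theorems
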